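import Summits.BirchSwinnertonDyer.Rank1Residual.GaloisImage.KummerConditionUnramifiedOfDivisible
import Summits.BirchSwinnertonDyer.Rank1Residual.GaloisImage.DivisibleCoreOfFiniteTorsion
import HarnessLib

/-!
# `H¹_ur(K_v, E[p^∞]) = 0` at `v ∤ p` as soon as the `D_v`-FIXED points of `E[p^∞]` have
# `I_v`-fixed `p^k`-th roots for every `k` (team n1011, seat p10 GEN 14 — TOOL)

HONEST FRAMING (cell `b2b-bsdres-*`, team n1011, verbatim): prove what is provable now; shrink each
hard class to its core with data; no claim beyond stated classes. Research route; TOOL theorems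
only — no definition, no named fact, nothing booked, no residual-map mark moved, no class closed.
Not a discharge of the registered fact A46 (`Fisher2016.thm44_selmerLocalKer_iff_of_nonsplit_good`;
its `v ∣ p` disjunct stays), not a re-key of any record (consumers' lineages), closes no row, no §K.2 letter
(cell row T-ROOT, lead R5-132).

## What

Row T-GP6 (GEN 11, `UnramifiedPrimaryVanishingOfDivisible`) proved `H¹_ur(K_v, E[p^∞]) = 0` at a
place `v ∤ p` under (DIV) "`N = E[p^∞]^{I_v}` is `p`-divisible" (which holds at `v ∤ p` when
`p ∤ #Φ_v(k̄)`, Gross–Parson's hypothesis).  This file proves it under the weaker and SHARP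
hypothesis

  (ROOT)  every `D_v`-fixed point of `E[p^∞]` has, for every `k`, a `p^k`-th root fixed by `I_v`,

i.e. `E(K_v)[p^∞]` lies in the maximal divisible subgroup of `E(K_v^nr)[p^∞]` — which holds, e.g.,
at every NON-SPLIT multiplicative `v ∤ p` for odd `p` with no condition on `ord_v Δ` (sibling file
`InertiaRootableNonsplitMultiplicative`), where (DIV) fails as soon as `p ∣ ord_v Δ`.

* §1 the core `C = {x ∈ N | x ∈ p^k N for all k}`: `p`-divisible (abstract lemma
  `exists_nsmul_eq_of_forall_exists_pow_nsmul_eq`, `E[p]` finite), stable under a Frobenius `φ`,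
  and `φ − 1` maps `C` ONTO `C` (the tree's counting lemma `exists_eq_of_finite_ker`: the kernel
  consists of `D_v`-fixed points, a finite set at `v ∤ p`, GEN 11 FILE 1a);
* §2 `exists_frob_smul_sub_eq_of_rootable` — under (ROOT), `ker (φ − 1) ⊆ C`, so `φ − 1` is onto
  `N` (abstract lemma `surjective_of_forall_exists_of_ker_subset`: the induced injective
  endomorphism of `N ⧸ C` is bijective on the finite images of the layers `N[p^k]`);
* §3 `resOfLe_inertia_injective_of_rootable` — `H¹(D_v, E[p^∞]) ↪ H¹(I_v, E[p^∞])`;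
* §4 `unramifiedSubgroup_primary_eq_bot_of_rootable` — `H¹_ur(K_v, E[p^∞]) = 0` in the cohomology
  of the completion (GEN 11 FILE 1b §3 verbatim on top of §3), with (ROOT) in the local form
  (`absInertia K_v`, `Γ_{K_v}` acting through `res`); and (DIV) ⟹ (ROOT) (`rootable_of_inertiaDivisible`).

References: [MilneADT2006] I §2, Prop. I.3.8; [GreenbergLNM1716] §3 Lemma 3.3 (pp. 86–88);
[SerreGaloisCohomology1997] I §2.6 (b); [GrossParson2011] Lemma 6 (p. 226).
-/

noncomputable section

open scoped Classical Topology Pointwise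

open NumberField IsDedekindDomain Field
open Literature.NumberTheory.EllipticCurves Literature.NumberTheory.EllipticCurves.GreenbergSelmer
open Literature.NumberTheory.GaloisRepresentations IsDedekindDomain.HeightOneSpectrum
open Literature.NumberTheory.GaloisRepresentations.IsNonarchimedeanLocalField

namespace Summit.BirchSwinnertonDyer.Rank1Residual.GaloisImage.InertiaDivisible

open Summit.BirchSwinnertonDyer.Rank1Residual.X11b.AcSelmer
open Summit.BirchSwinnertonDyer.Rank1Residual.X11b.LocBridge

section Curve

variable {K : Type} [Field K] [NumberField K] (E : WeierstrassCurve K) [E.IsElliptic]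
  (p : ℕ) [Fact p.Prime]

/-! ## §1–§2. `φ − 1` is onto `E[p^∞]^{I_v}` under (ROOT) at `v ∤ p` -/

/-- **At `v ∤ p`, under (ROOT), `φ − 1` is ONTO `N = E[p^∞]^{I_v}`** for an arithmetic Frobenius
`φ` at the chosen prime `𝔓₀ ∣ v`.  Let `C ≤ N` be the core of elements lying in `p^k N` for every
`k`.  (i) `C` is `p`-divisible (`exists_nsmul_eq_of_forall_exists_pow_nsmul_eq`; `E[p]` is finite);
(ii) `φ` preserves `N` (`I` is normalised by `φ`) and `C`, and `φ − 1` maps `C` onto `C` (counting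
lemma `exists_eq_of_finite_ker`: `C[p^k] ⊆ E[p^k]` is finite of `p`-power order and the kernel of
`φ − 1` consists of `D_{𝔓₀}`-fixed points, a finite set, `finite_setOf_forall_decompositionSubgroup_smul_eq`);
(iii) by (ROOT) the kernel of `φ − 1` on `N` lies in `C`; (iv) `surjective_of_forall_exists_of_ker_subset`.
(`H¹(D_v/I_v, N) = N/(φ − 1)N`, Milne *ADT* I §2; the good case is the tree's
`AcSelmer.exists_frob_smul_sub_eq`, the (DIV) case GEN 11's `exists_frob_smul_sub_eq_of_inertiaDivisible`.)
[cite: GreenbergLNM1716, §3 Lemma 3.3 (proof, p. 87)] [cite: MilneADT2006, Ch. I §2 (unramified cohomology)] -/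
theorem exists_frob_smul_sub_eq_of_rootable {v : HeightOneSpectrum (𝓞 K)}
    (hpv : (p : 𝓞 K) ∉ v.asIdeal)
    (hroot : ∀ t : E.geomPrimaryTorsion p,
      (∀ d ∈ (adicCompletionPrime K v).decompositionSubgroup (absoluteGaloisGroup K), d • t = t) →
      ∀ k : ℕ, ∃ s : E.geomPrimaryTorsion p,
        (∀ i ∈ (adicCompletionPrime K v).inertia (absoluteGaloisGroup K), i • s = s) ∧ p ^ k • s = t)
    {φ : absoluteGaloisGroup K} (hφ : IsArithFrobAt (𝓞 K) φ (adicCompletionPrime K v))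
    (m : E.geomPrimaryTorsion p)
    (hm : ∀ i ∈ (adicCompletionPrime K v).inertia (absoluteGaloisGroup K), i • m = m) :
    ∃ b : E.geomPrimaryTorsion p,
      (∀ i ∈ (adicCompletionPrime K v).inertia (absoluteGaloisGroup K), i • b = b) ∧ φ • b - b = m := by
  set I : Subgroup (absoluteGaloisGroup K) := (adicCompletionPrime K v).inertia (absoluteGaloisGroup K)
    with hIdef
  have hφD : φ ∈ (adicCompletionPrime K v).decompositionSubgroup (absoluteGaloisGroup K) :=
    hφ.mem_stabilizer
  -- the subgroup `N = E[p^∞]^I`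
  let N : AddSubgroup (E.geomPrimaryTorsion p) :=
    { carrier := {x | ∀ i ∈ I, i • x = x}
      add_mem' := fun {a b} ha hb i hi ↦ by rw [smul_add, ha i hi, hb i hi]
      zero_mem' := fun i _ ↦ smul_zero i
      neg_mem' := fun {a} ha i hi ↦ by rw [smul_neg, ha i hi] }
  have hNmem : ∀ x : E.geomPrimaryTorsion p, x ∈ N ↔ ∀ i ∈ I, i • x = x := fun _ ↦ Iff.rfl
  -- `φ` preserves `N`
  have hφN : ∀ x : E.geomPrimaryTorsion p, x ∈ N → φ • x ∈ N := by
    intro x hx i hi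
    have hi' : φ⁻¹ * i * φ ∈ I := inv_mul_mul_mem_inertia_adicCompletionPrime v hφD hi
    have e : i • φ • x = φ • ((φ⁻¹ * i * φ) • x) := by
      rw [← mul_smul, ← mul_smul]; congr 1; group
    rw [e, hx _ hi']
  let Φ : N →+ N :=
    { toFun := fun x ↦ ⟨φ • (x : E.geomPrimaryTorsion p), hφN _ x.2⟩
      map_zero' := Subtype.ext (by simp)
      map_add' := fun a b ↦ Subtype.ext (by simp only [AddSubgroup.coe_add, AddMemClass.mk_add_mk, smul_add]) }
  have hΦ : ∀ x : N, ((Φ x : N) : E.geomPrimaryTorsion p) = φ • (x : E.geomPrimaryTorsion p) :=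
    fun _ ↦ rfl
  let f : N →+ N := Φ - AddMonoidHom.id N
  have hf : ∀ x : N, ((f x : N) : E.geomPrimaryTorsion p) = φ • (x : E.geomPrimaryTorsion p) - x :=
    fun _ ↦ rfl
  -- every element of `N` is `p`-primary; the layers `N[p^k]` are finite of `p`-power order
  have htorsN : ∀ x : N, ∃ k : ℕ, p ^ k • x = 0 := by
    intro x
    obtain ⟨k, hk⟩ := (AddCommGroup.mem_primaryComponent).mp (x : E.geomPrimaryTorsion p).2
    exact ⟨k, Subtype.ext (Subtype.ext (by
      rw [AddSubmonoidClass.coe_nsmul, AddSubmonoidClass.coe_nsmul, ZeroMemClass.coe_zero,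
        ZeroMemClass.coe_zero]; exact hk))⟩
  have hinj : ∀ k : ℕ, ∃ g : AddSubgroup.torsionBy N (p ^ k : ℕ) →+
      AddSubgroup.torsionBy (E.geomPoints) (p ^ k : ℕ), Function.Injective g := by
    intro k
    refine ⟨{ toFun := fun x ↦ ⟨(((x : N) : E.geomPrimaryTorsion p) : E.geomPoints), ?_⟩
              map_zero' := Subtype.ext rfl
              map_add' := fun a b ↦ Subtype.ext rfl }, ?_⟩
    · have hx := AddSubgroup.torsionBy.nsmul_iff.mp x.2
      rw [AddSubgroup.torsionBy.nsmul_iff]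
      have h1 := congrArg (fun z : N ↦ ((z : E.geomPrimaryTorsion p) : E.geomPoints)) hx
      simpa only [AddSubmonoidClass.coe_nsmul, ZeroMemClass.coe_zero] using h1
    · intro a b hab
      have h := congrArg (fun z : AddSubgroup.torsionBy (E.geomPoints) (p ^ k : ℕ) ↦
        (z : E.geomPoints)) hab
      exact Subtype.ext (Subtype.ext (Subtype.ext h))
  have hcardE : ∀ k : ℕ, Nat.card (AddSubgroup.torsionBy (E.geomPoints) (p ^ k : ℕ)) = p ^ (2 * k) :=
    fun k ↦ by
      rw [pow_mul']
      exact WeierstrassCurve.card_torsionPoints_eq_sq_holds E (AlgebraicClosure K)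
        (by exact_mod_cast pow_ne_zero k (Fact.out : p.Prime).ne_zero)
  have hfinE : ∀ k : ℕ, Finite (AddSubgroup.torsionBy (E.geomPoints) (p ^ k : ℕ)) := fun k ↦
    Nat.finite_of_card_ne_zero (by rw [hcardE k]; exact pow_ne_zero _ (Fact.out : p.Prime).ne_zero)
  have hfinN : ∀ k : ℕ, (AddSubgroup.torsionBy N (p ^ k : ℕ) : Set N).Finite := by
    intro k
    obtain ⟨g, hg⟩ := hinj k
    haveI := hfinE k
    exact Set.finite_coe_iff.mp (Finite.of_injective g hg)
  have hfinN' : ∀ k : ℕ, {x : N | p ^ k • x = 0}.Finite := fun k ↦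
    (hfinN k).subset fun x hx ↦ AddSubgroup.torsionBy.nsmul_iff.mpr hx
  -- the core `C`
  let C : AddSubgroup N :=
    { carrier := {x | ∀ k : ℕ, ∃ y : N, p ^ k • y = x}
      add_mem' := fun {a b} ha hb k ↦ by
        obtain ⟨y, hy⟩ := ha k
        obtain ⟨z, hz⟩ := hb k
        exact ⟨y + z, by rw [smul_add, hy, hz]⟩
      zero_mem' := fun k ↦ ⟨0, smul_zero _⟩
      neg_mem' := fun {a} ha k ↦ by
        obtain ⟨y, hy⟩ := ha k
        exact ⟨-y, by rw [smul_neg, hy]⟩ }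
  have hCmem : ∀ x : N, x ∈ C ↔ ∀ k : ℕ, ∃ y : N, p ^ k • y = x := fun _ ↦ Iff.rfl
  -- (i) `C` is `p`-divisible
  have hfin1 : {t : N | p • t = 0}.Finite := by
    have h := hfinN' 1
    rwa [pow_one] at h
  have hdivC : ∀ a : C, ∃ b : C, p • b = a := by
    intro a
    have ha : ∀ k : ℕ, ∃ y ∈ (⊤ : AddSubgroup N), p ^ k • y = (a : N) := fun k ↦ by
      obtain ⟨y, hy⟩ := (hCmem _).mp a.2 k
      exact ⟨y, AddSubgroup.mem_top y, hy⟩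
    obtain ⟨y, -, hpy, hy⟩ := exists_nsmul_eq_of_forall_exists_pow_nsmul_eq ⊤ hfin1 ha
    exact ⟨⟨y, (hCmem y).mpr fun k ↦ by
      obtain ⟨z, -, hz⟩ := hy k
      exact ⟨z, hz⟩⟩, Subtype.ext hpy⟩
  -- (ii) `φ` and `f` preserve `C`; `f` maps `C` onto `C`
  have hΦC : ∀ x : N, x ∈ C → Φ x ∈ C := by
    intro x hx k
    obtain ⟨y, hy⟩ := (hCmem x).mp hx k
    exact ⟨Φ y, by rw [← map_nsmul, hy]⟩
  have hfC : ∀ x : N, x ∈ C → f x ∈ C := fun x hx ↦ by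
    change Φ x - x ∈ C
    exact C.sub_mem (hΦC x hx) hx
  let fC : C →+ C :=
    { toFun := fun x ↦ ⟨f (x : N), hfC _ x.2⟩
      map_zero' := Subtype.ext (map_zero f)
      map_add' := fun a b ↦ Subtype.ext (map_add f (a : N) (b : N)) }
  have hfC_coe : ∀ x : C, ((fC x : C) : N) = f x := fun _ ↦ rfl
  have hinjC : ∀ k : ℕ, ∃ g : AddSubgroup.torsionBy C (p ^ k : ℕ) →+
      AddSubgroup.torsionBy N (p ^ k : ℕ), Function.Injective g := by
    intro k
    refine ⟨{ toFun := fun x ↦ ⟨((x : C) : N), ?_⟩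
              map_zero' := Subtype.ext rfl
              map_add' := fun a b ↦ Subtype.ext rfl }, ?_⟩
    · have hx := AddSubgroup.torsionBy.nsmul_iff.mp x.2
      rw [AddSubgroup.torsionBy.nsmul_iff]
      have h1 := congrArg (fun z : C ↦ (z : N)) hx
      simpa only [AddSubmonoidClass.coe_nsmul, ZeroMemClass.coe_zero] using h1
    · intro a b hab
      have h := congrArg (fun z : AddSubgroup.torsionBy N (p ^ k : ℕ) ↦ (z : N)) hab
      exact Subtype.ext (Subtype.ext h)
  have hfinCk : ∀ k : ℕ, (AddSubgroup.torsionBy C (p ^ k : ℕ) : Set C).Finite := by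
    intro k
    obtain ⟨g, hg⟩ := hinjC k
    haveI := (hfinN k).to_subtype
    exact Set.finite_coe_iff.mp (Finite.of_injective g hg)
  have hcardC : ∀ k : ℕ, ∃ e : ℕ, Nat.card (AddSubgroup.torsionBy C (p ^ k : ℕ)) = p ^ e := by
    intro k
    obtain ⟨g, hg⟩ := hinjC k
    obtain ⟨g', hg'⟩ := hinj k
    have hdvd : Nat.card (AddSubgroup.torsionBy C (p ^ k : ℕ)) ∣ p ^ (2 * k) := by
      rw [← hcardE k]
      exact (AddSubgroup.card_dvd_of_injective g hg).trans (AddSubgroup.card_dvd_of_injective g' hg')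
    obtain ⟨e, -, he⟩ := (Nat.dvd_prime_pow (Fact.out : p.Prime)).mp hdvd
    exact ⟨e, he⟩
  -- the kernel of `φ − 1` on `N` consists of `D_{𝔓₀}`-fixed points: finite, and inside `C` by (ROOT)
  have hkerD : ∀ a : N, f a = 0 → ∀ d ∈ (adicCompletionPrime K v).decompositionSubgroup
      (absoluteGaloisGroup K), d • (a : E.geomPrimaryTorsion p) = a := by
    intro a ha d hd
    have hφa : φ • (a : E.geomPrimaryTorsion p) = a := by
      have h := congrArg (fun z : N ↦ (z : E.geomPrimaryTorsion p)) ha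
      simp only [hf, ZeroMemClass.coe_zero] at h
      exact sub_eq_zero.mp h
    exact smul_eq_of_mem_decompositionSubgroup_of_inertia_of_frob E p v hφ a.2 hφa hd
  have hkerC : ∀ a : N, f a = 0 → a ∈ C := by
    intro a ha k
    obtain ⟨s, hs, hps⟩ := hroot a (hkerD a ha) k
    exact ⟨⟨s, hs⟩, Subtype.ext hps⟩
  have hkerfin : {a : C | a ∈ AddCommGroup.primaryComponent C p ∧ fC a = 0}.Finite := by
    have hsub : (fun a : C ↦ ((a : N) : E.geomPrimaryTorsion p)) ''
        {a : C | a ∈ AddCommGroup.primaryComponent C p ∧ fC a = 0} ⊆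
        {t : E.geomPrimaryTorsion p |
          ∀ d ∈ (adicCompletionPrime K v).decompositionSubgroup (absoluteGaloisGroup K), d • t = t} := by
      rintro _ ⟨a, ⟨-, ha⟩, rfl⟩ d hd
      exact hkerD (a : N) (congrArg (fun z : C ↦ (z : N)) ha) d hd
    refine Set.Finite.of_finite_image
      ((finite_setOf_forall_decompositionSubgroup_smul_eq E p hpv).subset hsub) ?_
    intro a _ b _ hab
    exact Subtype.ext (Subtype.ext hab)
  have hsurjC : ∀ x : N, x ∈ C → ∃ y : N, y ∈ C ∧ f y = x := by
    intro x hx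
    have hxC : (⟨x, hx⟩ : C) ∈ AddCommGroup.primaryComponent C p := by
      obtain ⟨k, hk⟩ := htorsN x
      exact (AddCommGroup.mem_primaryComponent).mpr ⟨k, Subtype.ext hk⟩
    obtain ⟨z, -, hz⟩ := exists_eq_of_finite_ker hdivC hfinCk hcardC fC hkerfin hxC
    exact ⟨(z : N), z.2, congrArg (fun w : C ↦ (w : N)) hz⟩
  -- (iv) `f` is onto `N`
  have hsurj : Function.Surjective f :=
    surjective_of_forall_exists_of_ker_subset htorsN hfinN' f C hfC hsurjC hkerC
  obtain ⟨z, hz⟩ := hsurj ⟨m, hm⟩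
  refine ⟨z, z.2, ?_⟩
  have h := congrArg (fun w : N ↦ (w : E.geomPrimaryTorsion p)) hz
  simpa only [hf] using h

/-! ## §3. `H¹(D_v, E[p^∞]) ↪ H¹(I_v, E[p^∞])` under (ROOT) -/

/-- **`res : H¹(D_v, E[p^∞]) → H¹(I_v, E[p^∞])` is injective at `v ∤ p` under (ROOT)**
(`= H¹_ur(K_v, E[p^∞]) = E[p^∞]^{I_v}/(Frob_v − 1) = 0`, Milne *ADT* I §2): GEN 11 FILE 1a's
generic `resOfLe_injective_of_frobenius_generation_of_invariants` with `φ − 1` onto `E[p^∞]^{I}`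
from §2. [cite: GreenbergLNM1716, §3 Lemma 3.3 (pp. 86–88)] [cite: MilneADT2006, Ch. I §2 (unramified cohomology)] -/
theorem resOfLe_inertia_injective_of_rootable {v : HeightOneSpectrum (𝓞 K)}
    (hpv : (p : 𝓞 K) ∉ v.asIdeal)
    (hroot : ∀ t : E.geomPrimaryTorsion p,
      (∀ d ∈ (adicCompletionPrime K v).decompositionSubgroup (absoluteGaloisGroup K), d • t = t) →
      ∀ k : ℕ, ∃ s : E.geomPrimaryTorsion p,
        (∀ i ∈ (adicCompletionPrime K v).inertia (absoluteGaloisGroup K), i • s = s) ∧ p ^ k • s = t) :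
    Function.Injective
      (resOfLe (E.geomPrimaryTorsion p) (inertia_adicCompletionPrime_le_decomp v)) := by
  have h𝔓₀ := adicCompletionPrime_mem_primesAbove K v
  have e : decomp v = (adicCompletionPrime K v).decompositionSubgroup (absoluteGaloisGroup K) := by
    rw [decompositionSubgroup_adicCompletionPrime_eq_range]; rfl
  obtain ⟨φ, hφ⟩ := exists_isArithFrobAt_of_mem_primesAbove_holds h𝔓₀
  have hφD : φ ∈ decomp v := by rw [e]; exact hφ.mem_stabilizer
  refine resOfLe_injective_of_frobenius_generation_of_invariants
    (inertia_adicCompletionPrime_le_decomp v) (fun d hd i hi ↦ ?_) hφD (fun U hU d hd ↦ ?_)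
    (E.continuous_smul_geomPrimaryTorsion p)
    (fun m hm ↦ exists_frob_smul_sub_eq_of_rootable E p hpv hroot hφ m hm)
  · rw [e] at hd
    exact inv_mul_mul_mem_inertia_adicCompletionPrime v hd hi
  · rw [e] at hd
    exact exists_eq_frobenius_pow_mul_of_mem_decompositionSubgroup h𝔓₀ hφ hU hd

/-! ## §4. `H¹_ur(K_v, E[p^∞]) = 0` under (ROOT), local form -/

omit [E.IsElliptic] [Fact p.Prime] in
/-- (ROOT) in the local form (`Γ_{K_v}` and `absInertia K_v` acting through `res : Γ_{K_v} → Γ_K`)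
gives (ROOT) in the `𝔓₀`-form (`D_{𝔓₀} = res Γ_{K_v}`, `I_{𝔓₀} = res (absInertia K_v)`:
`decompositionSubgroup_adicCompletionPrime_eq_range`, `inertia_adicCompletionPrime_eq_map_absInertia`).
[cite: NeukirchANT1999, Ch. II §9 Prop. (9.6)] -/
theorem rootable_adicCompletionPrime_of_rootable_local {v : HeightOneSpectrum (𝓞 K)}
    (hroot : ∀ t : E.geomPrimaryTorsion p,
      (∀ σ : absoluteGaloisGroup (v.adicCompletion K),
        absGaloisRestrict K (v.adicCompletion K) σ • t = t) →
      ∀ k : ℕ, ∃ s : E.geomPrimaryTorsion p,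
        (∀ τ ∈ absInertia (v.adicCompletion K), absGaloisRestrict K (v.adicCompletion K) τ • s = s) ∧
          p ^ k • s = t)
    (t : E.geomPrimaryTorsion p)
    (ht : ∀ d ∈ (adicCompletionPrime K v).decompositionSubgroup (absoluteGaloisGroup K), d • t = t)
    (k : ℕ) :
    ∃ s : E.geomPrimaryTorsion p,
      (∀ i ∈ (adicCompletionPrime K v).inertia (absoluteGaloisGroup K), i • s = s) ∧ p ^ k • s = t := by
  have ht' : ∀ σ : absoluteGaloisGroup (v.adicCompletion K),
      absGaloisRestrict K (v.adicCompletion K) σ • t = t := fun σ ↦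
    ht _ (by rw [decompositionSubgroup_adicCompletionPrime_eq_range]; exact ⟨σ, rfl⟩)
  obtain ⟨s, hs, hps⟩ := hroot t ht' k
  exact ⟨s, (forall_inertia_adicCompletionPrime_smul_eq_iff E p v s).mpr hs, hps⟩

/-- **`unramifiedSubgroup (E[p^∞]|_{Γ_{K_v}}) 1 = ⊥` at `v ∤ p` under (ROOT)** (local form): a
class unramified in `H¹(Γ_{K_v}, E[p^∞])` is principal on `I_{K_v}`
(`LocBridge.mem_unramifiedSubgroup_one_iff_exists`), hence represented by a cocycle vanishing on
`I_{K_v}`; it descends to `D_v` (`LocBridge.oneCocycleClass_eq_zero_of_descent`) and dies by §3 —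
GEN 11 FILE 1b §3 verbatim.  The good case is the tree's `LocBridge.unramifiedSubgroup_primary_eq_bot`,
the (DIV) case GEN 11's `unramifiedSubgroup_primary_eq_bot_of_inertiaDivisible`.
[cite: MilneADT2006, Ch. I §2 (unramified cohomology)] [cite: GreenbergLNM1716, §3 Lemma 3.3 (pp. 86–88)] -/
theorem unramifiedSubgroup_primary_eq_bot_of_rootable {v : HeightOneSpectrum (𝓞 K)}
    (hpv : (p : 𝓞 K) ∉ v.asIdeal)
    (hroot : ∀ t : E.geomPrimaryTorsion p,
      (∀ σ : absoluteGaloisGroup (v.adicCompletion K),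
        absGaloisRestrict K (v.adicCompletion K) σ • t = t) →
      ∀ k : ℕ, ∃ s : E.geomPrimaryTorsion p,
        (∀ τ ∈ absInertia (v.adicCompletion K), absGaloisRestrict K (v.adicCompletion K) τ • s = s) ∧
          p ^ k • s = t) :
    DiscreteGaloisModule.unramifiedSubgroup
      (GaloisRep.restrictField (v.adicCompletion K) (primaryGaloisModule E p)) 1 = ⊥ := by
  haveI : CompactSpace (absoluteGaloisGroup (v.adicCompletion K)) :=
    absoluteGaloisGroup_compactSpace _
  have hroot' := rootable_adicCompletionPrime_of_rootable_local E p hroot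
  rw [eq_bot_iff]
  intro c hc
  obtain ⟨ψ, rfl⟩ := oneCocycleClass_surjective _ c
  rw [AddSubgroup.mem_bot]
  obtain ⟨w, hw⟩ := (mem_unramifiedSubgroup_one_iff_exists _ ψ).mp hc
  have hcontw : Continuous fun σ : absoluteGaloisGroup (v.adicCompletion K) ↦
      GaloisRep.restrictField (v.adicCompletion K) (primaryGaloisModule E p) σ w :=
    (E.continuous_smul_geomPrimaryTorsion p w).comp (absGaloisRestrict K (v.adicCompletion K)).continuous
  let δ : contOneCocycles (DiscreteGaloisModule.toTopRep
      (GaloisRep.restrictField (v.adicCompletion K) (primaryGaloisModule E p))) :=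
    ⟨⟨fun σ ↦ GaloisRep.restrictField (v.adicCompletion K) (primaryGaloisModule E p) σ w - w,
      hcontw.sub continuous_const⟩, fun g h ↦ by
        change absGaloisRestrict K (v.adicCompletion K) (g * h) • w - w =
          (absGaloisRestrict K (v.adicCompletion K) g • w - w) +
            absGaloisRestrict K (v.adicCompletion K) g • (absGaloisRestrict K (v.adicCompletion K) h • w - w)
        rw [map_mul, mul_smul, smul_sub]
        abel⟩
  have hδ : oneCocycleClass _ δ = 0 := (oneCocycleClass_eq_zero_iff _ δ).mpr ⟨w, fun _ ↦ rfl⟩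
  set ψ₁ := ψ - δ with hψ₁
  have hψ₁cls : oneCocycleClass _ ψ₁ = oneCocycleClass _ ψ := by
    rw [hψ₁, oneCocycleClass_sub, hδ, sub_zero]
  have hψ₁I : ∀ τ ∈ absInertia (v.adicCompletion K), ψ₁.1 τ = 0 := by
    intro τ hτ
    rw [hψ₁, Submodule.coe_sub, ContinuousMap.sub_apply, hw τ hτ]
    exact sub_self _
  have hψ : ∀ l : absoluteGaloisGroup (v.adicCompletion K),
      absGaloisRestrict K (v.adicCompletion K) l ∈
        (adicCompletionPrime K v).inertia (absoluteGaloisGroup K) → ψ₁.1 l = 0 := by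
    intro l hl
    rw [inertia_adicCompletionPrime_eq_map_absInertia] at hl
    obtain ⟨τ, hτ, hτl⟩ := hl
    have hτl' : absGaloisRestrict K (v.adicCompletion K) τ =
        absGaloisRestrict K (v.adicCompletion K) l := hτl
    have hn : absGaloisRestrict K (v.adicCompletion K) (τ⁻¹ * l) = 1 := by
      rw [map_mul, map_inv, ← hτl', inv_mul_cancel]
    have hnI := mem_absInertia_of_absGaloisRestrict_eq_one v hn
    have h := ψ₁.2 τ (τ⁻¹ * l)
    rw [mul_inv_cancel_left, hψ₁I τ hτ, hψ₁I _ hnI, map_zero, add_zero] at h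
    exact h
  rw [← hψ₁cls]
  exact oneCocycleClass_eq_zero_of_descent (absGaloisRestrict K (v.adicCompletion K)) (decomp v)
    (fun g ↦ (mem_decomp_iff v g).trans ⟨fun ⟨σ, h⟩ ↦ ⟨σ, h⟩, fun ⟨σ, h⟩ ↦ ⟨σ, h⟩⟩)
    (DiscreteGaloisModule.toTopRep
      (GaloisRep.restrictField (v.adicCompletion K) (primaryGaloisModule E p)))
    (TopRep.ofHom ⟨ContinuousLinearMap.id ℤ (E.geomPrimaryTorsion p), fun _ ↦ rfl⟩)
    Function.bijective_id (inertia_adicCompletionPrime_le_decomp v)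
    (resOfLe_inertia_injective_of_rootable E p hpv hroot') ψ₁ hψ

/-! ## §5. (DIV) ⟹ (ROOT) -/

omit [E.IsElliptic] [Fact p.Prime] in
/-- (DIV) "every `I_v`-fixed point of `E[p^∞]` is `p` times an `I_v`-fixed point" implies (ROOT)
(iterate `k` times; `D_v`-fixed points are `I_v`-fixed): GEN 11's theorems are special cases of
this file's. [folklore] -/
theorem rootable_of_inertiaDivisible {v : HeightOneSpectrum (𝓞 K)}
    (hdiv : ∀ t : E.geomPrimaryTorsion p,
      (∀ τ ∈ absInertia (v.adicCompletion K), absGaloisRestrict K (v.adicCompletion K) τ • t = t) →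
      ∃ s : E.geomPrimaryTorsion p,
        (∀ τ ∈ absInertia (v.adicCompletion K), absGaloisRestrict K (v.adicCompletion K) τ • s = s) ∧
          p • s = t)
    (t : E.geomPrimaryTorsion p)
    (ht : ∀ σ : absoluteGaloisGroup (v.adicCompletion K),
      absGaloisRestrict K (v.adicCompletion K) σ • t = t) (k : ℕ) :
    ∃ s : E.geomPrimaryTorsion p,
      (∀ τ ∈ absInertia (v.adicCompletion K), absGaloisRestrict K (v.adicCompletion K) τ • s = s) ∧
        p ^ k • s = t :=
  exists_pow_smul_eq_of_inertiaDivisible E p k hdiv t fun τ _ ↦ ht τ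

end Curve

end Summit.BirchSwinnertonDyer.Rank1Residual.GaloisImage.InertiaDivisible

end
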